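import Summits.QuantumFields.YangMills.Theorems.UnitScaleTiltProp7CovKernelMemberSizes
import Summits.QuantumFields.YangMills.Theorems.UnitScaleTiltProp7CovKernelMemberRows
import Summits.QuantumFields.YangMills.Theorems.UnitScaleTiltProp7ConeRegaugeInst
import Summits.QuantumFields.YangMills.Theorems.UnitScaleTiltProp7MemberBallFrames
import Summits.QuantumFields.YangMills.Theorems.UnitScaleTiltProp7ExactCorrectorGaugeSockets
import HarnessLib

/-!
# Route `UnitScaleTilt`, crux K1 «MinimiserStabilityRegPr» (stmt-QuantumFields-19200), route-R E′ path (α′), (E1-b) at the CURVED background — (A-cov) MEMBER ROWS, part 2b «BOND DATA»: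
# AT THE MEMBER OF RECORD (`W ∈ RegPr`, `L·L^{a′}·α₀ ≤ a₅`) AND ONE POLE `x₀`, EVERYTHING ✓ `exists_gen0_package` ∕ ✓ `htr_body_of_rows'''` ∕ ✓ `gen0_total_le` READ ABOUT THE FRAME AND THE WEIGHT,
# WITH THE CONE LETTERS PACKAGED AS THREE REALS `A₀ A₁ A₂`: bi-contractivity of `𝒰` and `Fr`, `Fr x₀ = 1`, the anchor `Fr(T_μx₀) = 𝒰_μ(x₀)⁻¹`, the rows `h1 h1' h2` on `S′ = {tdist ≤ 9ℓ_k + ℓ_k}`,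
# the sizes `A₁ℓ_k² ≤ α`, `A₀ℓ_k² ≤ α`, `A₂ℓ_k³ ≤ α` (`α = c35a₅e^{c35a₅}(1 + 4c35a₅e^{c35a₅})`), and the Agmon weight of rate `κ∕ℓ_k` with its four door rows, `W₀ ≤ (5∕κ)√(5∕κ)ℓ_k√ℓ_k`, `ω ≤ e^{11κ}` on `S′`

Cell `ym3-torus`, width seat `ym3-torus-px22` (gen 3).  One `obtain` each of routeR-w4 g11's ✓p681171 `exists_coneFrame_rows_anchored_of_regPr` (radius `ρ = 9ℓ_k + ℓ_k`, `2(ρ+1)+4 ≤ bigSide` by px4's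
✓ `forty_mul_le_bigSide`) and ✓ `cone_letter_sizes_member`, ✓ `exists_weight_rows`, ✓ `weight_count_le`, ✓ `weight_on_ball_le`.  THEOREMS ONLY (0 `def`, 0 `sorry`); `--supports stmt-QuantumFields-19200`,
count-neutral.  YM₃ on T³ is a ladder rung (R3), not the Clay problem; nothing here claims the stub, the crux, d = 4 or the gap.

References: T. Bałaban, CMP 99 (1985) 389–434 [Balaban1985BackgroundPropagators] ((3.28) p.395, (3.35) p.396); CMP 96 (1984) 223–250 [Balaban1984PropagatorsII] ((1.9) p.226, (2.61) p.234);
CMP 99 (1985) 75–102 [Balaban1985RegularSpaces] ((1.33) p.82).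
-/

set_option autoImplicit false

noncomputable section

open scoped BigOperators Matrix.Norms.L2Operator Matrix
open Finset

namespace Summit.QuantumFields.YangMills.Theorems.Prop7CovKernelMemberBondData

open Literature.MathematicalPhysics.QuantumFieldTheory.Balaban1983to89
open Literature.MathematicalPhysics.QuantumFieldTheory.Balaban1983to89.T3ContinuumYM3Torus
open Literature.MathematicalPhysics.QuantumFieldTheory.Balaban1983to89.T3PrintedRegularMinimiser (RegPr)
open Literature.MathematicalPhysics.QuantumFieldTheory.Balaban1983to89.B6GlobalChartV1 (PV)
open B9TorusCalculus (torusT)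
open B6MultiLevelBoxOperator (bigSide)
open B10Eq27TorusAxialLog (unitsField toUField)
open Summit.QuantumFields.YangMills.Theorems.Prop7SectET3Members (hd3)
open Summit.QuantumFields.YangMills.Theorems.Prop7ConeRegaugeInst (exists_coneFrame_rows_anchored_of_regPr cone_letter_sizes_member)
open Summit.QuantumFields.YangMills.Theorems.Prop7MemberBallFrames (forty_mul_le_bigSide)
open Summit.QuantumFields.YangMills.Theorems.Prop7ExactCorrectorGaugeSockets (unitsField_toUField_norm_le_one)
open Summit.QuantumFields.YangMills.Theorems.Prop7CovKernelMemberRows (exists_weight_rows)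
open Summit.QuantumFields.YangMills.Theorems.Prop7CovKernelMemberSizes (weight_count_le weight_on_ball_le)

variable {ℓ : ℕ} {hL : Odd (ℓ + 1) ∧ 1 < ℓ + 1}

/-- ★★★ **THE (A-cov) BOND DATA AT THE MEMBER** (see the module docstring). [cite: Balaban1985BackgroundPropagators, (3.28) p.395, (3.35) p.396; Balaban1984PropagatorsII, (1.9) p.226, (2.61) p.234] -/
theorem exists_member_bond_data (hℓ4 : 4 ≤ ℓ) : ∃ c35 a₅ : ℝ, 0 < c35 ∧ 0 < a₅ ∧
    ∀ (hℓ : 4 ≤ ℓ) (m : ℕ) (hm : 1 ≤ m) (n K a' R : ℕ) (hk1 : 1 ≤ K - n) (hsize : a' + 3 ≤ m + n) (hM8 : 8 ≤ (ℓ + 1) ^ a')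
      (hR2 : 2 * (ℓ + 1) ^ 2 ≤ R) (α₀ : ℝ), 0 < α₀ → ((ℓ + 1 : ℕ) : ℝ) * (((ℓ + 1) ^ a' : ℕ) : ℝ) * α₀ ≤ a₅ →
      ∀ W : GaugeField (PV 2 ℓ m K hd3 hL) 0 (Matrix.specialUnitaryGroup (Fin 2) ℂ),
        RegPr (⟨ℓ + 1, hL, m, hm⟩ : T3Family) n K α₀ W →
        ∀ (x₀ : Site (PV 2 ℓ m K hd3 hL) 0) (κ : ℝ), 0 < κ → κ ≤ 1 →
          ∃ (Fr : Site (PV 2 ℓ m K hd3 hL) 0 → (Matrix (Fin 2) (Fin 2) ℂ)ˣ) (ω : Site (PV 2 ℓ m K hd3 hL) 0 → ℝ) (A₀ A₁ A₂ : ℝ),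
            (∀ (κ' : Fin (PV 2 ℓ m K hd3 hL).d) (y : Site (PV 2 ℓ m K hd3 hL) 0), ‖(unitsField (toUField W) ⟨y, κ'⟩ : Matrix (Fin 2) (Fin 2) ℂ)‖ ≤ 1 ∧
              ‖(((unitsField (toUField W) ⟨y, κ'⟩)⁻¹ : (Matrix (Fin 2) (Fin 2) ℂ)ˣ) : Matrix (Fin 2) (Fin 2) ℂ)‖ ≤ 1) ∧
            (∀ z : Site (PV 2 ℓ m K hd3 hL) 0, ‖(Fr z : Matrix (Fin 2) (Fin 2) ℂ)‖ ≤ 1 ∧ ‖(((Fr z)⁻¹ : (Matrix (Fin 2) (Fin 2) ℂ)ˣ) : Matrix (Fin 2) (Fin 2) ℂ)‖ ≤ 1) ∧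
            Fr x₀ = 1 ∧
            (∀ μ : Fin (PV 2 ℓ m K hd3 hL).d, Fr (torusT (PV 2 ℓ m K hd3 hL) 0 μ x₀) = (unitsField (toUField W) ⟨x₀, μ⟩)⁻¹) ∧
            0 ≤ A₀ ∧ 0 ≤ A₁ ∧ 0 ≤ A₂ ∧
            (∀ z ∈ (univ.filter fun z : Site (PV 2 ℓ m K hd3 hL) 0 => Site.tdist z x₀ ≤ 9 * (PV 2 ℓ m K hd3 hL).L ^ (K - n) + (PV 2 ℓ m K hd3 hL).L ^ (K - n)),
              ∀ μ : Fin (PV 2 ℓ m K hd3 hL).d,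
              ‖(((Fr z)⁻¹ * unitsField (toUField W) ⟨z, μ⟩ * Fr (torusT (PV 2 ℓ m K hd3 hL) 0 μ z) : (Matrix (Fin 2) (Fin 2) ℂ)ˣ) : Matrix (Fin 2) (Fin 2) ℂ) - 1‖
                ≤ A₁ * ((Site.tdist z x₀ : ℝ) + 1)) ∧
            (∀ z ∈ (univ.filter fun z : Site (PV 2 ℓ m K hd3 hL) 0 => Site.tdist z x₀ ≤ 9 * (PV 2 ℓ m K hd3 hL).L ^ (K - n) + (PV 2 ℓ m K hd3 hL).L ^ (K - n)),
              ∀ μ : Fin (PV 2 ℓ m K hd3 hL).d,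
              ‖(((Fr ((torusT (PV 2 ℓ m K hd3 hL) 0 μ).symm z))⁻¹ * unitsField (toUField W) ⟨(torusT (PV 2 ℓ m K hd3 hL) 0 μ).symm z, μ⟩
                  * Fr (torusT (PV 2 ℓ m K hd3 hL) 0 μ ((torusT (PV 2 ℓ m K hd3 hL) 0 μ).symm z)) : (Matrix (Fin 2) (Fin 2) ℂ)ˣ) : Matrix (Fin 2) (Fin 2) ℂ) - 1‖
                ≤ A₁ * ((Site.tdist z x₀ : ℝ) + 1)) ∧
            (∀ z ∈ (univ.filter fun z : Site (PV 2 ℓ m K hd3 hL) 0 => Site.tdist z x₀ ≤ 9 * (PV 2 ℓ m K hd3 hL).L ^ (K - n) + (PV 2 ℓ m K hd3 hL).L ^ (K - n)),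
              ∀ μ : Fin (PV 2 ℓ m K hd3 hL).d,
              ‖(((Fr z)⁻¹ * unitsField (toUField W) ⟨z, μ⟩ * Fr (torusT (PV 2 ℓ m K hd3 hL) 0 μ z) : (Matrix (Fin 2) (Fin 2) ℂ)ˣ) : Matrix (Fin 2) (Fin 2) ℂ)
                - (((Fr ((torusT (PV 2 ℓ m K hd3 hL) 0 μ).symm z))⁻¹ * unitsField (toUField W) ⟨(torusT (PV 2 ℓ m K hd3 hL) 0 μ).symm z, μ⟩
                  * Fr (torusT (PV 2 ℓ m K hd3 hL) 0 μ ((torusT (PV 2 ℓ m K hd3 hL) 0 μ).symm z)) : (Matrix (Fin 2) (Fin 2) ℂ)ˣ) : Matrix (Fin 2) (Fin 2) ℂ)‖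
                ≤ A₀ + A₂ * ((Site.tdist z x₀ : ℝ) + 2)) ∧
            A₁ * ((((ℓ + 1 : ℕ) : ℝ) ^ (K - n)) ^ 2) ≤ c35 * a₅ * Real.exp (c35 * a₅) * (1 + 4 * (c35 * a₅ * Real.exp (c35 * a₅))) ∧
            A₀ * ((((ℓ + 1 : ℕ) : ℝ) ^ (K - n)) ^ 2) ≤ c35 * a₅ * Real.exp (c35 * a₅) * (1 + 4 * (c35 * a₅ * Real.exp (c35 * a₅))) ∧
            A₂ * ((((ℓ + 1 : ℕ) : ℝ) ^ (K - n)) ^ 3) ≤ c35 * a₅ * Real.exp (c35 * a₅) * (1 + 4 * (c35 * a₅ * Real.exp (c35 * a₅))) ∧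
            (∀ z, 0 < ω z) ∧
            (∀ z ν, |ω (z.shift ν) - ω z| ≤ (2 * κ / (((ℓ + 1 : ℕ) : ℝ) ^ (K - n))) * ω z ∧ |ω (z.unshift ν) - ω z| ≤ (2 * κ / (((ℓ + 1 : ℕ) : ℝ) ^ (K - n))) * ω z) ∧
            (∀ z ν, |ω (z.shift ν) + ω (z.unshift ν) - 2 * ω z| ≤ (4 * κ / (((ℓ + 1 : ℕ) : ℝ) ^ (K - n)) ^ 2) * ω z) ∧
            Real.sqrt (∑ z, (ω z)⁻¹ ^ 2) ≤ (5 / κ) * Real.sqrt (5 / κ) * (((ℓ + 1 : ℕ) : ℝ) ^ (K - n)) * Real.sqrt (((ℓ + 1 : ℕ) : ℝ) ^ (K - n)) ∧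
            (∀ z ∈ (univ.filter fun z : Site (PV 2 ℓ m K hd3 hL) 0 => Site.tdist z x₀ ≤ 9 * (PV 2 ℓ m K hd3 hL).L ^ (K - n) + (PV 2 ℓ m K hd3 hL).L ^ (K - n)),
              0 ≤ ω z ∧ ω z ≤ Real.exp (11 * κ)) := by
  obtain ⟨c35, a₅, hc35, ha₅, H⟩ := exists_coneFrame_rows_anchored_of_regPr (hL := hL) hℓ4
  refine ⟨c35, a₅, hc35, ha₅, ?_⟩
  intro hℓ m hm n K a' R hk1 hsize hM8 hR2 α₀ hα₀ hMα W hreg x₀ κ hκ0 hκ1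
  -- the radius `ρ = 9ℓ_k + ℓ_k` fits the frame ball (`2(ρ+1)+4 = 20ℓ_k + 6 ≤ 40ℓ_k ≤ bigSide`)
  have hx1 : 1 ≤ (ℓ + 1) ^ (K - n) := Nat.one_le_pow _ _ (by omega)
  have hbig := forty_mul_le_bigSide (K := K) (n := n) hℓ hM8
  have hLdef : (PV 2 ℓ m K hd3 hL).L = ℓ + 1 := rfl
  have hρ : 2 * ((9 * (PV 2 ℓ m K hd3 hL).L ^ (K - n) + (PV 2 ℓ m K hd3 hL).L ^ (K - n)) + 1) + 4 ≤ bigSide ℓ ((ℓ + 1) ^ a') (K - n) := by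
    rw [hLdef]; omega
  obtain ⟨Fr, hFr, hFr1, hpole, h1, h1', h2⟩ := H hℓ m hm n K a' R hk1 hsize hM8 hR2 α₀ hα₀ hMα W hreg x₀ _ hρ
  obtain ⟨hA₁, hA₀, hA₂, hA₀0, hA₁0, hA₂0⟩ := cone_letter_sizes_member (ℓ := ℓ) (K := K) (n := n) (a' := a') hc35 hα₀ hMα
  -- the weight
  have hℓk1 : (1 : ℝ) ≤ ((ℓ + 1 : ℕ) : ℝ) ^ (K - n) := one_le_pow₀ (by exact_mod_cast (show 1 ≤ ℓ + 1 by omega))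
  have hℓk0 : (0 : ℝ) < ((ℓ + 1 : ℕ) : ℝ) ^ (K - n) := by linarith
  obtain ⟨ω, hω₀, hω₁, hω₂, hcount, hhi⟩ := exists_weight_rows (P := PV 2 ℓ m K hd3 hL) (j := 0) x₀ hℓk1 hκ0 hκ1
  have hd : (PV 2 ℓ m K hd3 hL).d = 3 := rfl
  have hmem : ∀ z ∈ (univ.filter fun z : Site (PV 2 ℓ m K hd3 hL) 0 => Site.tdist z x₀ ≤ 9 * (PV 2 ℓ m K hd3 hL).L ^ (K - n) + (PV 2 ℓ m K hd3 hL).L ^ (K - n)),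
      Site.tdist z x₀ ≤ 9 * (PV 2 ℓ m K hd3 hL).L ^ (K - n) + (PV 2 ℓ m K hd3 hL).L ^ (K - n) := fun z hz => (Finset.mem_filter.1 hz).2
  refine ⟨Fr, ω, _, _, _, fun κ' y => unitsField_toUField_norm_le_one W ⟨y, κ'⟩, hFr, hFr1, hpole, hA₀0, hA₁0, hA₂0,
    fun z hz μ => h1 z (hmem z hz) μ, fun z hz μ => h1' z (hmem z hz) μ, fun z hz μ => h2 z (hmem z hz) μ, hA₁, hA₀, hA₂, hω₀, hω₁, hω₂, ?_, fun z hz => ⟨(hω₀ z).le, ?_⟩⟩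
  · -- the count at `d = 3`
    rw [hd] at hcount
    exact hcount.trans (weight_count_le hκ0 hκ1 hℓk1)
  · -- on the ball
    refine (hhi z).trans (weight_on_ball_le hκ0.le hℓk0 ?_)
    have := hmem z hz
    rw [hLdef] at this
    exact_mod_cast this

end Summit.QuantumFields.YangMills.Theorems.Prop7CovKernelMemberBondData

end
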